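/-
Copyright (c) 2026 the pub-hodgecm-mathlib formalisation cell (harness21).  Prover seat hodgecm-mathlib-B-p08 (g41): unit U2G_Census, TIER-2 file paying the stub
`stub_U2G_dict_unit0 : PieceCountDictionary pieceUnit0 cntUnit0` of `Cruxes/H413/Lines/F0_P3c_DyRamFourFrame/U2G_Census.lean`; 2026-09-03.
-/
import Summits.HodgeConjecture.HodgeConjecture.Theorems.F0P3cDyRamFourFrameCensusDefs          -- U2G DEFS LEAF (B-p08 (g41)): `PieceCountDictionary`, `cntUnit0`
import Summits.HodgeConjecture.HodgeConjecture.Theorems.F0P3cDyRamAnchorCountDictionaryZero   -- ★ p854635 (LH4-p01 (g17)): `classOrbitalIntegral_indicator_eq_mul_fixedVertexCount_zero`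
import Literature.NumberTheory.Automorphic.UnitaryLatticeTreeFixedCosetStrataDictionary         -- ★ `mapGL_stdLattice_eq_iff_mem_glInt` (`k·L₀ = L₀ ↔ k ∈ GL₃(𝒪)`)
import Literature.NumberTheory.Automorphic.UnitaryLatticeTreeStarOfInvolution                  -- ★ `isSelfDualLattice_stdLattice_three_of_v` (the root is a type-0 vertex)
import Literature.NumberTheory.Automorphic.LocalUnitaryIntegralLevel                           -- ★ `mem_localIntegralLevel_iff_of_smul_eq` (`u ∈ K ↔ ι_w u ∈ GL₃(𝒪_w)`)
import HarnessLib

/-!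
# Crux `H413`, line LH4 «(D-RAM) FOUR-FRAME» road — unit U2G, TIER 2: the census dictionary of the anchor piece `1_K` with the EXPLICIT constant,
# `PieceCountDictionary pieceUnit0 cntUnit0` (pays `U2G_Census.stub_U2G_dict_unit0` BY NAME)

Cell `hodgecm-mathlib` (D-0151), FLOOR 0, crux item H413 = `stmt-HodgeConjecture-24833`, route of record `HCCMUnconditional`; squad F0∕P3c∕LH4 (req618); tier-1 unit U2G_Census
(assembler B-p08 (g41); desk INVENTORY v1 56a02b7f4f575bad §U2G row `dict_unit0`).  THEOREMS ONLY (one theorem; no `def`, no instance, no notation, no `sorry`, default heartbeats);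
lane `--supports stmt-HodgeConjecture-24833 --as helper` (count-neutral).

WHAT IS PROVED.  `pieceCountDictionary_unit0 : PieceCountDictionary pieceUnit0 cntUnit0` — at every wild ramified non-split place, for the canonical orbital family `mG₃` and every
TYPE-(1) literal `γ` (place matrix `z·Γ_b`, `Γ_b = frameElt σ_w f b α β` in a four-frame family, `α, β, z ∈ E¹`, `α ≠ β`, `α, β ≠ 1`):
`Φ(⟦γ⟧, 1_K; mG₃) = νG₃(K).toReal · fixedVertexCount σ_w ϖ 0 (ι_w γ)`, `K = cmLocalIntegralLevel L 3 Φ₃ v`.  PROOF: ★ p854635's all-binders lemma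
`classOrbitalIntegral_indicator_eq_mul_fixedVertexCount_zero` at the ROOT `N = 𝒪_w³` (a type-0 vertex, ★ `isSelfDualLattice_stdLattice_three_of_v`) with `K_t := K`, whose stabiliser
clause `u ∈ K ↔ ι_w(u)·𝒪³ = 𝒪³` is ★ `mem_localIntegralLevel_iff_of_smul_eq` (`u ∈ K ↔ ι_w u ∈ GL₃(𝒪_w)`) + ★ `mapGL_stdLattice_eq_iff_mem_glInt`; finally the frame literal
`Γ_b` is replaced by `ι_w γ = z·Γ_b` in the count by ★ `fixedVertexCount_eq_of_coe_eq_smul` (`|z| = 1`, ★ `v_eq_one_of_mul_map_eq_one`).  This is (D-G) `AnchorCountDictionary 0`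
(★ `anchorCountDictionary_zero`) RE-PINNED to `K` with the constant exhibited — the normalisation in which unit U4 reads the whole piece table.

HONEST LABEL.  Count-neutral; the verdict of record for (D-RAM) stays PRINT [LanglandsShelstad1989 Thm. p. 484 ∕ Rogawski1990 Prop. 4.9.1 (a)] ∕ XL; `HC_CM` is proved only
modulo the 7 printed citations (2 remaining: hLiu418 = `stmt-HodgeConjecture-24832`, h413 = `stmt-HodgeConjecture-24833`) until rung 0 closes.

## References
* [Kottwitz1986] R. E. Kottwitz, *Base change for unit elements of Hecke algebras*, Compositio Math. 60 (1986), §3.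
* [Rogawski1990] J. D. Rogawski, *Automorphic Representations of Unitary Groups in Three Variables*, Ann. of Math. Stud. 123 (1990), §4.9 Prop. 4.9.1 (b) p. 55.
* [Laumon1995] G. Laumon, *Cohomology of Drinfeld Modular Varieties I* (1996), Lemma (5.3.2) p. 136.
-/

noncomputable section

namespace Summit.HodgeConjecture.HodgeConjecture.Cruxes.H413.F0P3cDyRamPieceCountDictionaryUnit0

open MeasureTheory Measure NumberField IsDedekindDomain Topology Filter
open Literature.NumberTheory.Automorphic Literature.NumberTheory.Automorphic.UnitaryGroup Literature.NumberTheory.Automorphic.IntegralReduction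
open Literature.NumberTheory.Automorphic.UnitaryLatticeTree Literature.NumberTheory.Automorphic.HermitianLattice
open Literature.NumberTheory.Rogawski1990 Literature.NumberTheory.GaloisRepresentations
open Literature.MeasureTheory.Group (descConj)
open Literature.NumberTheory.Automorphic.UnitaryThreeFourFrame
open Summit.HodgeConjecture.HodgeConjecture.Cruxes.H413.F0P3cDyRamFourFramePieces
open Summit.HodgeConjecture.HodgeConjecture.Cruxes.H413.F0P3cDyRamFourFrameCensusDefs
open Summit.HodgeConjecture.HodgeConjecture.Cruxes.H413.F0P3cDyRamAnchorCountDictionaryZero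
open scoped Matrix MatrixGroups Classical ValuativeRel WithZero

/-- **`PieceCountDictionary pieceUnit0 cntUnit0` — THE ANCHOR DICTIONARY AT `K = Stab(𝒪_w³)` WITH THE CONSTANT `νG₃(K)`** (pays `U2G_Census.stub_U2G_dict_unit0` BY NAME):
`Φ(⟦γ⟧, 1_K; mG₃) = νG₃(K).toReal · n₀(ι_w γ)` for every type-(1) literal `γ` at every wild ramified non-split place.  ★ p854635 at the root + ★ `mem_localIntegralLevel_iff_of_smul_eq`
+ ★ `mapGL_stdLattice_eq_iff_mem_glInt` + ★ `fixedVertexCount_eq_of_coe_eq_smul`. [cite: Kottwitz1986, §3] [cite: Rogawski1990, §4.9 Prop. 4.9.1 (b) p. 55] [cite: Laumon1995, Lemma (5.3.2) p. 136] -/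
theorem pieceCountDictionary_unit0 : PieceCountDictionary pieceUnit0 cntUnit0 := by
  intro L _ _ _ v w hw he _h2 ϖ hϖ _ _ _ _ νG₃ _ _ mG₃ hcan f hf α β z hα hβ hz hαβ hα1 hβ1 b Γ hΓ γ hγ
  have hvσ : ∀ a : w.1.adicCompletion L, Valued.v (galAdicCompletionMap (L := L) (IsCMField.complexConj L) hw a) = Valued.v a :=
    fun a => valued_galAdicCompletionMap (L := L) (IsCMField.complexConj L) hw a
  -- the root `𝒪_w³` is a type-0 vertex, and `K` is its stabiliser under `ι_w`
  have hN : IsVertexLattice (galAdicCompletionMap (L := L) (IsCMField.complexConj L) hw) ϖ ((StdForm.antidiagonal 3).over (w.1.adicCompletion L)) 0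
      (stdLattice (w.1.adicCompletion L) 3) :=
    isSelfDualLattice_stdLattice_three_of_v hϖ
  have hKt : ∀ u : ((UnitaryGroup.cmDatum L 3 (Matrix.of fun i j : Fin 3 => if i.val + j.val + 1 = 3 then (1 : L) else 0)).Local v),
      u ∈ cmLocalIntegralLevel L 3 (Matrix.of fun i j : Fin 3 => if i.val + j.val + 1 = 3 then (1 : L) else 0) v ↔
        mapGL ((localNonsplitEquiv (IsCMField.complexConj L) (Matrix.of fun i j : Fin 3 => if i.val + j.val + 1 = 3 then (1 : L) else 0) (IsCMField.complexConj_ne_one L) w hw u :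
          ↥(unitaryGroupOfForm (galAdicCompletionMap (L := L) (IsCMField.complexConj L) hw) (placeForm (Matrix.of fun i j : Fin 3 => if i.val + j.val + 1 = 3 then (1 : L) else 0) w.1))) : GL (Fin 3) (w.1.adicCompletion L))
          (stdLattice (w.1.adicCompletion L) 3) = stdLattice (w.1.adicCompletion L) 3 :=
    fun u => (mem_localIntegralLevel_iff_of_smul_eq (IsCMField.complexConj L) 3 (Matrix.of fun i j : Fin 3 => if i.val + j.val + 1 = 3 then (1 : L) else 0) (IsCMField.complexConj_ne_one L) w hw u).trans
      (mapGL_stdLattice_eq_iff_mem_glInt _).symm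
  have key := classOrbitalIntegral_indicator_eq_mul_fixedVertexCount_zero L w hw he hϖ νG₃ hcan hN (cmLocalIntegralLevel L 3 (Matrix.of fun i j : Fin 3 => if i.val + j.val + 1 = 3 then (1 : L) else 0) v) hKt hf hα hβ hz hαβ hα1 hβ1 b hΓ γ hγ
  have hz1 : Valued.v z = 1 := v_eq_one_of_mul_map_eq_one hvσ hz
  show classOrbitalIntegral mG₃ (Set.indicator (cmLocalIntegralLevel L 3 (Matrix.of fun i j : Fin 3 => if i.val + j.val + 1 = 3 then (1 : L) else 0) v : Set ((UnitaryGroup.cmDatum L 3 (Matrix.of fun i j : Fin 3 => if i.val + j.val + 1 = 3 then (1 : L) else 0)).Local v)) (fun _ => (1 : ℂ)))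
      (ConjClasses.mk γ) = _ * (fixedVertexCount (galAdicCompletionMap (L := L) (IsCMField.complexConj L) hw) ϖ 0 _ : ℂ)
  rw [key, fixedVertexCount_eq_of_coe_eq_smul (galAdicCompletionMap (L := L) (IsCMField.complexConj L) hw) ϖ 0 hz1 hγ]

end Summit.HodgeConjecture.HodgeConjecture.Cruxes.H413.F0P3cDyRamPieceCountDictionaryUnit0

end
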